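import Mathlib
import Literature.NumberTheory.Transcendental.ZagierDilogarithmConjecture
import Literature.NumberTheory.Transcendental.BlochWignerDilogarithm
import Literature.NumberTheory.Transcendental.PreBlochRelationCriterion
import Summits.KontsevichZagierPeriods.KontsevichZagierPeriods.Theorems.ZagierDilogarithmConjecture.Negative.DehnInvariant
import Summits.KontsevichZagierPeriods.KontsevichZagierPeriods.Theorems.HyperbolicBlochZagierDilogarithmConjectureGaloisSlices
import Summits.KontsevichZagierPeriods.KontsevichZagierPeriods.Theorems.HyperbolicBlochZagierDilogarithmConjectureStubHeptagonalCertificate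
import Summits.KontsevichZagierPeriods.KontsevichZagierPeriods.Theorems.HyperbolicBlochZagierDilogarithmConjectureStubHeptagonalDehnZero
import HarnessLib

/-!
# `ZagierDilogarithmConjecture` (stmt-KontsevichZagierPeriods-10550) — line
`kummer-clausen-linearisation` (reshape c2), stub `stub_heptagonalRelation`: an explicit relation in a
field with THREE complex places, certified modulo Borel–Suslin

Let `ζ = e^{2πi/7}`, `x = (1 + √−7)/2`, `y = (−1 + √−7)/4`. Numerically (item evidence
`slice-relations.md`; double precision, < 1e-12)

    7·(D(ζ) + D(ζ²) − D(ζ³)) = 8·D(x) + 4·D(y)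

for the Bloch–Wigner dilogarithm `D` — a `ℤ`-relation among values at algebraic points of `ℍ⁺` lying in
`ℚ(ζ₇)` (`r₂ = 3`), hence outside every number field with one complex place (lead c1's Borel slice cannot
reach it). **Theorem (`stub_heptagonalRelation`).** IF the relation is exact, THEN its formal combination
`β₇ = 7[ζ] + 7[ζ²] − 7[ζ³] − 8[x] − 4[y]` lies in `⟨dilogRelators⟩` (five-term relators over `ℚ̄`, conjugation
pairs, real points) — GIVEN Dupont 2001 Thm. 10.24 a) (Borel + Suslin), an explicit hypothesis. This is the
line's `stub_cyclotomicSignedSlice` (`N = 7`, `k = 5`) with all its hypotheses DISCHARGED: the Gauss period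
`ζ + ζ² + ζ⁴ = (−1+√−7)/2`, positivity and the vanishing of every Dehn invariant (`…StubHeptagonalDehnZero`),
and the signed Galois certificate for every `j` coprime to `7` (`…StubHeptagonalCertificate`).

Borel's theorem predicts that the relation IS exact (the `H`-odd part of `B(ℚ(ζ₇)) ⊗ ℚ`, `H = {1,2,4}`, is
`B(ℚ(√−7)) ⊗ ℚ`, of rank one; both sides are rational multiples of `√7·ζ_{ℚ(√−7)}(2)/π²`), but no proof of the
numerical identity is claimed: it is the hypothesis. Sorry-free; axioms ⊆ {propext, Classical.choice,
Quot.sound}.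
-/

noncomputable section

open scoped BigOperators ComplexConjugate
open Literature.NumberTheory.Transcendental
open Summit.KontsevichZagierPeriods.HyperbolicBloch.ZagierDilogarithmConjectureNegative (dehn)

namespace Summit.KontsevichZagierPeriods.HyperbolicBloch.ZagierDilogarithmGaloisDescent

/-- **Stub `stub_heptagonalRelation`: the heptagonal relation is explained, mod Borel–Suslin.** With
`ζ = e^{2πi/7}`, `x = (1+√−7)/2`, `y = (−1+√−7)/4`: IF `7D(ζ) + 7D(ζ²) − 7D(ζ³) − 8D(x) − 4D(y) = 0` THEN
`7[ζ] + 7[ζ²] − 7[ζ³] − 8[x] − 4[y] ∈ ⟨dilogRelators⟩`, GIVEN Dupont 2001 Thm. 10.24 a) — by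
`stub_cyclotomicSignedSlice` (`N = 7`, `k = 5`). [cite: Dupont2001, Thm. 10.24 a)] -/
theorem stub_heptagonalRelation :
    Dupont2001_preBloch_relation_of_invariants →
    7 * blochWignerDilog (Complex.exp (2 * Real.pi * Complex.I / 7)) +
          7 * blochWignerDilog (Complex.exp (2 * Real.pi * Complex.I / 7) ^ 2) -
          7 * blochWignerDilog (Complex.exp (2 * Real.pi * Complex.I / 7) ^ 3) -
          8 * blochWignerDilog ((1 + (Real.sqrt 7 : ℂ) * Complex.I) / 2) -
          4 * blochWignerDilog ((-1 + (Real.sqrt 7 : ℂ) * Complex.I) / 4) = 0 →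
      ((7 : ℤ) • FreeAbelianGroup.of (Complex.exp (2 * Real.pi * Complex.I / 7)) +
          (7 : ℤ) • FreeAbelianGroup.of (Complex.exp (2 * Real.pi * Complex.I / 7) ^ 2) -
          (7 : ℤ) • FreeAbelianGroup.of (Complex.exp (2 * Real.pi * Complex.I / 7) ^ 3) -
          (8 : ℤ) • FreeAbelianGroup.of ((1 + (Real.sqrt 7 : ℂ) * Complex.I) / 2) -
          (4 : ℤ) • FreeAbelianGroup.of ((-1 + (Real.sqrt 7 : ℂ) * Complex.I) / 4)) ∈
        AddSubgroup.closure dilogRelators := by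
  intro hD hvol
  -- abbreviations
  set ζ : ℂ := Complex.exp (2 * Real.pi * Complex.I / 7) with hζdef
  set x : ℂ := (1 + (Real.sqrt 7 : ℂ) * Complex.I) / 2 with hxdef
  set y : ℂ := (-1 + (Real.sqrt 7 : ℂ) * Complex.I) / 4 with hydef
  -- the Gauss period: cyclotomic coordinates of `x` and `y`
  have hη : ζ + ζ ^ 2 + ζ ^ 4 = (-1 + (Real.sqrt 7 : ℂ) * Complex.I) / 2 := hept_gaussPeriod
  have hX : 1 + ζ + ζ ^ 2 + ζ ^ 4 = x := by
    rw [hxdef, add_assoc, add_assoc, ← add_assoc ζ, hη]; ring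
  have hY : (ζ + ζ ^ 2 + ζ ^ 4) / 2 = y := by rw [hη, hydef]; ring
  have hfun : (![ζ, ζ ^ 2, ζ ^ 3, 1 + ζ + ζ ^ 2 + ζ ^ 4, (ζ + ζ ^ 2 + ζ ^ 4) / 2] : Fin 5 → ℂ) =
      ![ζ, ζ ^ 2, ζ ^ 3, x, y] := by
    rw [hX, hY]
  -- the inputs of the slice theorem, transported to the `√7`-form of the points
  have hcoords : ∀ i : Fin 5, (![ζ, ζ ^ 2, ζ ^ 3, x, y] : Fin 5 → ℂ) i =
      ∑ m : Fin 7, ((![![0, 1, 0, 0, 0, 0, 0], ![0, 0, 1, 0, 0, 0, 0], ![0, 0, 0, 1, 0, 0, 0],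
        ![1, 1, 1, 0, 1, 0, 0], ![0, 1/2, 1/2, 0, 1/2, 0, 0]] : Fin 5 → Fin 7 → ℚ) i m : ℂ) *
          ζ ^ (m : ℕ) := by
    rw [← hfun]; exact hept_coords
  have hcert := stub_heptagonalCertificate
  rw [hfun] at hcert
  have him : ∀ i : Fin 5, 0 < ((![ζ, ζ ^ 2, ζ ^ 3, x, y] : Fin 5 → ℂ) i).im := hept_im_pos
  have hdehn : ∀ u v : Additive ℂˣ →+ ℚ, dehn u v (∑ i : Fin 5, (![7, 7, -7, -8, -4] : Fin 5 → ℤ) i •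
      FreeAbelianGroup.of ((![ζ, ζ ^ 2, ζ ^ 3, x, y] : Fin 5 → ℂ) i)) = 0 := stub_heptagonalDehnZero
  have hsum : ∑ i : Fin 5, ((![7, 7, -7, -8, -4] : Fin 5 → ℤ) i : ℝ) *
      blochWignerDilog ((![ζ, ζ ^ 2, ζ ^ 3, x, y] : Fin 5 → ℂ) i) = 0 := by
    simp only [Fin.sum_univ_five, Matrix.cons_val_zero, Matrix.cons_val_one, Matrix.head_cons,
      Matrix.cons_val_two, Matrix.tail_cons, Matrix.cons_val_three, Matrix.cons_val_four]
    push_cast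
    linear_combination hvol
  have key := stub_cyclotomicSignedSlice hD 7 (by norm_num) 5 (![ζ, ζ ^ 2, ζ ^ 3, x, y])
    (![7, 7, -7, -8, -4]) _ hcoords hcert him hdehn hsum
  have e : (∑ i : Fin 5, (![7, 7, -7, -8, -4] : Fin 5 → ℤ) i •
      FreeAbelianGroup.of ((![ζ, ζ ^ 2, ζ ^ 3, x, y] : Fin 5 → ℂ) i)) =
      (7 : ℤ) • FreeAbelianGroup.of ζ + (7 : ℤ) • FreeAbelianGroup.of (ζ ^ 2) -
        (7 : ℤ) • FreeAbelianGroup.of (ζ ^ 3) - (8 : ℤ) • FreeAbelianGroup.of x -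
        (4 : ℤ) • FreeAbelianGroup.of y := by
    simp only [Fin.sum_univ_five, Matrix.cons_val_zero, Matrix.cons_val_one, Matrix.head_cons,
      Matrix.cons_val_two, Matrix.tail_cons, Matrix.cons_val_three, Matrix.cons_val_four, neg_smul]
    abel
  rwa [e] at key

end Summit.KontsevichZagierPeriods.HyperbolicBloch.ZagierDilogarithmGaloisDescent

end
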